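import Summits.QuantumFields.YangMills.Theorems.BalabanUVNodesN15KingModelTranslationCovarianceReflections
import HarnessLib

/-!
# BalabanUVNodes ∕ N15 — THE KING-MODEL RUNG (PART Ν-a, v1.1 doc-only erratum): THE FREE-BOUNDARY (NEUMANN) OPERATOR `c(−Δ_free)+m²` ON THE BOX `Ω = Π_μ{0,…,n_μ−1}`, THE DOUBLED
# TORUS `Π_μ ℤ∕2n_μ` WITH ITS `2^{d+1}` MULTI-REFLECTIONS `σ_S`, AND THE REFLECTION PRINCIPLE IN ALL `d+1` DIRECTIONS
# (Track A, DAG node N15 = NE2; FAN-OUT v1.1 §N15 s3 «KING-MODEL RUNG» — its named alternative currency «torus-vs-box twin»; count-neutral)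

HONEST FRAMING.  Count-neutral (cell `pub-ymgap`, seat `pub-ymgap-dag-n15-e` g39; `--supports stmt-QuantumFields-27366 --as helper` = K3⁸).
TEMPLATE LITERATURE: C. King, Commun. Math. Phys. **102** (1986) 649–677 [King1986] §4 p.670 l.8–13 (verbatim in the ATTRIBUTION paragraph below):
the Ω-propagators are multiple-reflection sums, after [Ba 4] = [Balaban1983RegularityDecay] (2.42) p.584, of «the operator defined by (2.13) with free
boundary conditions (and A = 0, of course)»; [Balaban1984PropagatorsII] (2.37) p.229 (Neumann boundary conditions on a box by reflections).  PART Ϲ-g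
(`…KingModelPathResolvent`) typed the `d = 1` factor of the method of images in its doubled-torus form.  THIS FILE and its sequel Ν-a′
(`…KingModelBoxResolvent`) type the method in ALL `d+1` directions at once, in the same doubled-TORUS (periodized) form, for King's `A = 0` covariance
`(c(−Δ)+m²)⁻¹` as carried by this lineage on tori (`King1986.Torus.lapF`).  Here: the Neumann («free») boundary-condition operator `c(−Δ_free)+m²` on the
box `Ω = Π_μ {0,…,n_μ−1}` (any sides `n_μ ≥ 1`) as an explicit matrix `boxOp` (§1); the box inside the DOUBLED torus `Π_μ ℤ∕2n_μ` (§2, `dblBox`), on which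
the `2^{d+1}` multi-reflections `σ_S` (`x_μ ↦ −1 − x_μ` for `μ ∈ S ⊆ {0,…,d}`; iterates of dag-n15-a N-Ia's block-face reflection `torRefl`) act, leaving
King's torus covariance invariant (`lapF_inv_torReflS`, from part Ϙ-f's `lapF_inv_torRefl`), and under which the proper images of box points leave the box
(`dblBox_ne_torReflS`); and (§3) THE REFLECTION PRINCIPLE: a `σ`-even function on the doubled torus satisfies the free-boundary stencil on the box — across
a face of `Ω` the torus stencil reaches the mirror image of the site itself, so the bond difference vanishes, which is exactly the Neumann boundary condition
(★★ **`lapF_mulVec_even_dblBox`**).  §4 records the image-sum kernel `kingBoxGreen n c m² s t := Σ_S B⁻¹_{T(2n)}(dblBox s, σ_S(dblBox t))` and the evenness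
of its columns (`imageColumn_even`); that it inverts `boxOp` is Ν-a′.

ATTRIBUTION ∕ ERRATUM (v1.1, doc-only; ref-I READ-925 LOCATED-1, bus ERRATUM-Ν1).  King's p.670 text (§4, l.8–13) is: «By using multiple reflection
representations, the propagators G^η_k and G^η_k(Ω) can be written in terms of the operator defined by (2.13) with free boundary conditions (and A = 0,
of course), as long as Ω is a rectangular parallelepiped which is a union of blocks of L^k sites. Such representations are given explicitly in [Ba 4], so
it is sufficient to prove Propositions 3.8 and 3.9 for the operator with free boundary conditions» — King, following [Ba 4] = [Balaban1983RegularityDecay]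
(2.42) p.584, writes the Ω-propagators as image sums of the operator on the INFINITE lattice `ηℤ^d` («free boundary conditions») and proves his estimates
for that operator.  v1.0 of this header said «every estimate is proved on the torus and transported to Ω» and called the doubled-torus image sum «the
step itself»: that was a misreading — the TORUS is this lineage's carrier for King's operators (`King1986.Torus.lapF`), and the `2^{d+1}`-image sum over
the torus of doubled periods is the PERIODIZED, FINITE form of [Ba 4]'s image series (its image group `Bool^{d+1} × ℤ^{d+1}` modulo the period lattice),
a device of these files (the classical method of images); the boundary condition on the box so represented is the Neumann («free») condition of
[Ba 4]'s `G_j(□)` ∕ [Balaban1984PropagatorsII] (2.37).  Every declaration of v1.0 is byte-identical; only prose is corrected.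
NOT Bałaban's covariant `G(Ω)` with a background field; NOT a node discharge (N15 is booked through n15-a's knit, untouched); nothing continuum-YM ∕
`ℝ⁴` ∕ OS axioms ∕ Clay.  0 `sorry`.

PRIOR TREE ART (named, not restated).  (i) Route AllWindowsColdBox, `…Theorems.AllWindowsColdBox.BoxKernel` (`AllWindowsColdBoxBoxKernelReflection` ∕
`…Green`): the SIGNED image sum for the MASSLESS Laplacian on a cube `{0,…,M−1}^d` with MIXED Dirichlet∕Neumann faces (a non-empty Dirichlet set is
required there — the massless Neumann problem is singular), over the zero-mode-removed torus Green function of `Literature.Probability.LatticeModels`;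
(ii) dag-n15-a PROGRAMME N (`…N15NeumannCubePropagator`): Neumann-by-images for Bałaban's VECTOR operator `Δ_a` on bonds at `U ≡ 1` as the operator
`Sym∘G∘χ°` on the doubled torus (no box carrier, no inverse identified); (iii) dag-n15-w5 `…N15TorusBoxCharts` (windows ∕ charts of a box inside a torus).
The present objects are King's: the MASSIVE scalar operator (4.4) (`m² > 0`, so ALL faces free = King's boundary condition, and the image sum is
UNSIGNED), rectangular boxes of arbitrary sides, King's torus covariance `lapF⁻¹` of the N15 rung.  The image device itself is classical (method of images).

OBJECTS (data).  `KingBox n = Π_μ Fin (n μ)`; `boxSucc`∕`boxPred` (in-box neighbours); `boxOp n c m² : Matrix (KingBox n) (KingBox n) ℝ`; `torReflS K S` (multi-reflection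
on any torus `Tor K`); `dblPer n = (2n_μ)_μ`, `dblBox n : KingBox n → Tor (dblPer n)`; `kingBoxGreen n c m² s t := Σ_S (lapF (dblPer n) c m²)⁻¹ (dblBox s) (σ_S (dblBox t))`.

WHAT THIS FILE PROVES (kernel).  §1 ★ `boxOp_mulVec_apply` (the free-boundary stencil `m²f(s) + cΣ_μ([s_μ+1<n_μ](f(s)−f(s+e_μ)) + [0<s_μ](f(s)−f(s−e_μ)))`),
`boxOp_mulVec_const` (`(c(−Δ_free)+m²)𝟙 = m²𝟙`).  §2 `torReflS_empty`, `torReflS_torReflS`, `torReflS_insert`, `torReflS_symmDiff_singleton`, `torReflS_eq_torRefl_symmDiff`,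
★ `lapF_inv_torReflS` (`B⁻¹(σ_S x, σ_S y) = B⁻¹(x,y)`), `lapF_inv_comm`, `val_dblBox`, `dblBox_injective`, `val_neg_one_sub_natCast`, `val_mirror_dblBox`
(`val(−1 − t_μ) = 2n_μ − 1 − t_μ`: the mirror coordinate is outside the box), ★ `dblBox_ne_torReflS`, `dblBox_eq_torReflS_iff`.  §3 `dblBox_add_unitVec`, `dblBox_sub_unitVec`,
★ `torRefl_dblBox_add_unitVec` ∕ `torRefl_dblBox_sub_unitVec` (across a face the outside neighbour is the mirror image of the site), ★★ **`lapF_mulVec_even_dblBox`**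
(THE REFLECTION PRINCIPLE: `((c(−Δ)+m²)F)(dblBox s) = ((c(−Δ_free)+m²)(F∘dblBox))(s)` for `σ`-even `F`).  §4 def `kingBoxGreen`, ★ `imageColumn_even` (reindex
`S ↦ S △ {κ}`).

HONEST SCOPE.  Any `d`, any sides `n_μ ≥ 1`, any `c, m²` (no sign needed in this file); the doubled torus has EVEN periods `2n_μ` by construction.  King's
`A = 0` scalar model only; N15 untouched; counts unmoved.  Locators: [King1986] §4 p.670 l.8–13, (2.13) p.653 (the operator), (4.4) p.670 (its symbol), (2.17) p.653;
[Balaban1983RegularityDecay] (2.42) p.584; [Balaban1984PropagatorsII] (2.37) p.229 (Neumann boundary conditions by reflection — cited as SHAPE).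
-/

noncomputable section

open scoped BigOperators symmDiff
open Finset Matrix

namespace Summit.QuantumFields.YangMills.BalabanUVNodes.N15KingModelRung.TorusSpectral

open Literature.MathematicalPhysics.QuantumFieldTheory.Balaban1983to89.B5Prop11Plancherel (Tor unitVec)
open Literature.MathematicalPhysics.QuantumFieldTheory.King1986.Torus
open Summit.QuantumFields.YangMills.BalabanUVNodes.N15.TwoGrid (torRefl torRefl_torRefl torRefl_apply_same torRefl_apply_ne torRefl_injective
  torRefl_bijective sum_torRefl)
open Summit.QuantumFields.YangMills.BalabanUVNodes.N15KingModelRung.Curved (lapF_inv_torRefl)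

variable {d : ℕ}

/-! ## §1 King's rectangular box `Π_μ {0,…,n_μ−1}` and the free-boundary operator `c(−Δ_free) + m²` -/

section BoxOp

variable (n : Fin (d + 1) → ℕ)

/-- THE RECTANGULAR BOX `Ω = Π_μ {0,…,n_μ − 1}` (sites; one finite interval per direction; King's «rectangular parallelepiped» p.670). [cite: King1986, §4 p.670] -/
abbrev KingBox : Type := (μ : Fin (d + 1)) → Fin (n μ)

/-- The `+e_μ` neighbour inside the box (defined when `s_μ + 1 < n_μ`). [folklore] -/
def boxSucc (s : KingBox n) (μ : Fin (d + 1)) (h : (s μ).val + 1 < n μ) : KingBox n := Function.update s μ ⟨(s μ).val + 1, h⟩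

/-- The `−e_μ` neighbour inside the box (defined when `0 < s_μ`). [folklore] -/
def boxPred (s : KingBox n) (μ : Fin (d + 1)) (h : 0 < (s μ).val) : KingBox n :=
  Function.update s μ ⟨(s μ).val - 1, lt_trans (Nat.sub_lt h Nat.one_pos) (s μ).isLt⟩

/-- THE NEUMANN («free») BOUNDARY-CONDITION VERSION ON THE BOX of King's stencil `c(−Δ) + m²` ((2.13) ∕ symbol (4.4)): `(s,t) ↦ m²[t=s] + c·Σ_μ Σ_{bonds of
direction μ at s}([t = s] − [t = other end])` — the operator of the quadratic form `m²Σ_s f(s)² + cΣ_{bonds ⟨s,s′⟩ ⊂ Ω}(f(s) − f(s′))²`; no term for the missing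
neighbours of boundary sites ([Ba 4] (2.42)'s `G_j(□)` boundary condition). [cite: King1986, (2.13) p.653, §4 p.670; Balaban1983RegularityDecay, (2.42) p.584] -/
def boxOp (c m2 : ℝ) : Matrix (KingBox n) (KingBox n) ℝ := fun s t =>
  m2 * (if t = s then 1 else 0)
    + c * ∑ μ : Fin (d + 1),
        ((if h : (s μ).val + 1 < n μ then ((if t = s then (1 : ℝ) else 0) - (if t = boxSucc n s μ h then 1 else 0)) else 0)
          + (if h : 0 < (s μ).val then ((if t = s then (1 : ℝ) else 0) - (if t = boxPred n s μ h then 1 else 0)) else 0))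

/-- ★ THE FREE-BOUNDARY STENCIL: `((c(−Δ_free)+m²)f)(s) = m²f(s) + cΣ_μ([s_μ+1 < n_μ](f(s) − f(s+e_μ)) + [0 < s_μ](f(s) − f(s−e_μ)))`. [cite: King1986, (4.4) p.670] -/
theorem boxOp_mulVec_apply (c m2 : ℝ) (f : KingBox n → ℝ) (s : KingBox n) :
    (boxOp n c m2 *ᵥ f) s
      = m2 * f s + c * ∑ μ : Fin (d + 1), ((if h : (s μ).val + 1 < n μ then f s - f (boxSucc n s μ h) else 0)
          + (if h : 0 < (s μ).val then f s - f (boxPred n s μ h) else 0)) := by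
  have hpt : ∀ t : KingBox n, boxOp n c m2 s t * f t
      = m2 * ((if t = s then (1 : ℝ) else 0) * f t)
        + c * ∑ μ : Fin (d + 1),
            ((if h : (s μ).val + 1 < n μ then ((if t = s then (1 : ℝ) else 0) - (if t = boxSucc n s μ h then 1 else 0)) else 0) * f t
              + (if h : 0 < (s μ).val then ((if t = s then (1 : ℝ) else 0) - (if t = boxPred n s μ h then 1 else 0)) else 0) * f t) := by
    intro t
    unfold boxOp
    rw [add_mul, mul_assoc, mul_assoc, Finset.sum_mul]
    simp only [add_mul]
  have h1 : ∑ t : KingBox n, (if t = s then (1 : ℝ) else 0) * f t = f s := by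
    simp_rw [ite_mul, one_mul, zero_mul]
    rw [Finset.sum_ite_eq' Finset.univ s]; simp
  have hd : ∀ (p : Prop) [Decidable p] (u : p → KingBox n),
      ∑ t : KingBox n, (if h : p then ((if t = s then (1 : ℝ) else 0) - (if t = u h then 1 else 0)) else 0) * f t
        = if h : p then f s - f (u h) else 0 := by
    intro p _ u
    by_cases hp : p
    · simp only [hp, dif_pos, sub_mul, ite_mul, one_mul, zero_mul, Finset.sum_sub_distrib, Finset.sum_ite_eq', Finset.mem_univ, if_true]
    · simp [hp]
  simp only [Matrix.mulVec, dotProduct]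
  simp_rw [hpt]
  rw [Finset.sum_add_distrib, ← Finset.mul_sum, ← Finset.mul_sum, h1, Finset.sum_comm]
  congr 1
  refine congrArg _ (Finset.sum_congr rfl fun μ _ => ?_)
  rw [Finset.sum_add_distrib, hd _ (fun h => boxSucc n s μ h), hd _ (fun h => boxPred n s μ h)]

/-- The free-boundary operator KILLS CONSTANTS up to the mass term: `(c(−Δ_free)+m²)𝟙 = m²𝟙` (every bond difference of a constant vanishes; no boundary term). [folklore] -/
theorem boxOp_mulVec_const (c m2 a : ℝ) : boxOp n c m2 *ᵥ (fun _ => a) = fun _ => m2 * a := by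
  funext s
  rw [boxOp_mulVec_apply]
  simp

end BoxOp

/-! ## §2 The doubled torus `Π_μ ℤ∕2n_μ`, the box inside it, and the multi-reflections `σ_S` -/

section Doubling

variable (K : Fin (d + 1) → ℕ)

section MultiReflection

/-- THE MULTI-REFLECTION `σ_S` (`S ⊆ {0,…,d}` a set of directions): `x_μ ↦ −1 − x_μ` for `μ ∈ S`, `x_μ ↦ x_μ` otherwise — the iterate of the block-face
reflections `torRefl` (dag-n15-a N-Ia) over the directions of `S`; `σ_∅ = 1`, `σ_{S}σ_{S} = 1`. [cite: King1986, §4 p.670] -/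
def torReflS (S : Finset (Fin (d + 1))) (x : Tor K) : Tor K := fun μ => if μ ∈ S then -1 - x μ else x μ

/-- `σ_∅ = 1`. [folklore] -/
@[simp] theorem torReflS_empty (x : Tor K) : torReflS K ∅ x = x := by
  funext μ; simp [torReflS]

/-- `σ_S σ_S = 1`. [folklore] -/
@[simp] theorem torReflS_torReflS (S : Finset (Fin (d + 1))) (x : Tor K) : torReflS K S (torReflS K S x) = x := by
  funext μ; by_cases h : μ ∈ S <;> simp [torReflS, h]

/-- `σ_{S ∪ {κ}} = σ_κ ∘ σ_S` for `κ ∉ S`. [folklore] -/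
theorem torReflS_insert {κ : Fin (d + 1)} {S : Finset (Fin (d + 1))} (hκ : κ ∉ S) (x : Tor K) :
    torReflS K (insert κ S) x = torRefl K κ (torReflS K S x) := by
  funext μ
  by_cases h : μ = κ
  · subst h; simp [torReflS, hκ]
  · simp [torReflS, h]

/-- `σ_{S △ {κ}} = σ_κ ∘ σ_S` (toggling one direction). [folklore] -/
theorem torReflS_symmDiff_singleton (κ : Fin (d + 1)) (S : Finset (Fin (d + 1))) (x : Tor K) :
    torReflS K (S ∆ {κ}) x = torRefl K κ (torReflS K S x) := by
  funext μ
  by_cases h : μ = κ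
  · subst h
    by_cases hS : μ ∈ S
    · simp [torReflS, Finset.mem_symmDiff, hS]
    · simp [torReflS, Finset.mem_symmDiff, hS]
  · have : (μ ∈ S ∆ {κ}) ↔ μ ∈ S := by simp [Finset.mem_symmDiff, h]
    simp only [torReflS, this, torRefl_apply_ne _ h]

/-- `σ_S x = σ_κ (σ_{S △ {κ}} x)`. [folklore] -/
theorem torReflS_eq_torRefl_symmDiff (κ : Fin (d + 1)) (S : Finset (Fin (d + 1))) (x : Tor K) :
    torReflS K S x = torRefl K κ (torReflS K (S ∆ {κ}) x) := by
  rw [torReflS_symmDiff_singleton, torRefl_torRefl]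

end MultiReflection

section TorusCovariance

variable [hK : ∀ μ, NeZero (K μ)]

/-- ★ `B⁻¹(σ_S x, σ_S y) = B⁻¹(x, y)`: King's torus covariance is invariant under every multi-reflection (iterate of `lapF_inv_torRefl`). [cite: King1986, (4.4) p.670, (2.17) p.653] -/
theorem lapF_inv_torReflS (c m2 : ℝ) (S : Finset (Fin (d + 1))) (x y : Tor K) :
    (lapF K c m2)⁻¹ (torReflS K S x) (torReflS K S y) = (lapF K c m2)⁻¹ x y := by
  induction S using Finset.induction_on generalizing x y with
  | empty => simp
  | insert κ S hκ ih => rw [torReflS_insert K hκ, torReflS_insert K hκ, lapF_inv_torRefl, ih]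

/-- `Bᵀ = B` ⇒ `B⁻¹(x,y) = B⁻¹(y,x)`. [folklore] -/
theorem lapF_inv_comm (c m2 : ℝ) (x y : Tor K) : (lapF K c m2)⁻¹ x y = (lapF K c m2)⁻¹ y x := by
  have hT : (lapF K c m2)ᵀ = lapF K c m2 := by
    ext z z'; rw [Matrix.transpose_apply]; exact lapF_comm K c m2 z z'
  rw [← Matrix.transpose_apply (lapF K c m2)⁻¹ y x, Matrix.transpose_nonsing_inv, hT]

end TorusCovariance

variable (n : Fin (d + 1) → ℕ) [hn : ∀ μ, NeZero (n μ)]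

/-- The periods `2n_μ` of the DOUBLED torus. [folklore] -/
abbrev dblPer : Fin (d + 1) → ℕ := fun μ => 2 * n μ

/-- The box point `s` read in the doubled torus `Π_μ ℤ∕2n_μ`. [folklore] -/
def dblBox (s : KingBox n) : Tor (dblPer n) := fun μ => (((s μ).val : ℕ) : ZMod (2 * n μ))

omit hn in
/-- `val (dblBox s)_μ = s_μ`. [folklore] -/
theorem val_dblBox (s : KingBox n) (μ : Fin (d + 1)) : (dblBox n s μ).val = (s μ).val := by
  simp only [dblBox]
  exact ZMod.val_cast_of_lt (show (s μ).val < 2 * n μ by have := (s μ).isLt; omega)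

omit hn in
/-- `dblBox` is injective. [folklore] -/
theorem dblBox_injective : Function.Injective (dblBox n) := by
  intro s t h
  funext μ
  apply Fin.ext
  rw [← val_dblBox n s μ, ← val_dblBox n t μ, h]

/-- In `ℤ∕2m`: `val(−1 − k) = 2m − 1 − k` for `k < 2m`. [folklore] -/
theorem val_neg_one_sub_natCast (m : ℕ) [NeZero m] {k : ℕ} (hk : k < 2 * m) :
    ((-1 - (k : ZMod (2 * m)) : ZMod (2 * m))).val = 2 * m - 1 - k := by
  have h : (-1 - (k : ZMod (2 * m)) : ZMod (2 * m)) = ((2 * m - 1 - k : ℕ) : ZMod (2 * m)) := by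
    have h2m : ((2 * m : ℕ) : ZMod (2 * m)) = 0 := ZMod.natCast_self _
    have hc : (((2 * m - 1 - k : ℕ) : ZMod (2 * m))) + k + 1 = ((2 * m : ℕ) : ZMod (2 * m)) := by
      norm_cast; congr 1; omega
    rw [h2m] at hc
    linear_combination -hc
  rw [h, ZMod.val_cast_of_lt (by omega)]

/-- The mirror coordinate is OUTSIDE the box: `val(−1 − (dblBox t)_μ) = 2n_μ − 1 − t_μ ≥ n_μ`. [cite: King1986, §4 p.670] -/
theorem val_mirror_dblBox (t : KingBox n) (μ : Fin (d + 1)) : (-1 - dblBox n t μ).val = 2 * n μ - 1 - (t μ).val := by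
  simp only [dblBox]
  exact val_neg_one_sub_natCast (n μ) (by have := (t μ).isLt; omega)

/-- ★ A box point is NEVER a proper image of a box point: `dblBox s = σ_S(dblBox t)` forces `S = ∅` (and then `s = t`). [cite: King1986, §4 p.670] -/
theorem dblBox_ne_torReflS {S : Finset (Fin (d + 1))} (hS : S.Nonempty) (s t : KingBox n) : dblBox n s ≠ torReflS (dblPer n) S (dblBox n t) := by
  obtain ⟨κ, hκ⟩ := hS
  intro h
  have hc := congrArg (fun z => (z κ).val) h
  simp only [torReflS, hκ, if_true] at hc
  rw [val_dblBox, val_mirror_dblBox] at hc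
  have h1 := (s κ).isLt
  have h2 := (t κ).isLt
  have h3 := NeZero.pos (n κ)
  omega

/-- `dblBox s = σ_S(dblBox t) ↔ S = ∅ ∧ s = t`. [folklore] -/
theorem dblBox_eq_torReflS_iff (S : Finset (Fin (d + 1))) (s t : KingBox n) :
    dblBox n s = torReflS (dblPer n) S (dblBox n t) ↔ S = ∅ ∧ s = t := by
  constructor
  · intro h
    rcases S.eq_empty_or_nonempty with hS | hS
    · subst hS
      rw [torReflS_empty] at h
      exact ⟨rfl, dblBox_injective n h⟩
    · exact absurd h (dblBox_ne_torReflS n hS s t)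
  · rintro ⟨rfl, rfl⟩; simp

end Doubling

/-! ## §3 The reflection principle: a `σ`-even function on the doubled torus satisfies the free-boundary stencil on the box -/

section Reflection

variable (n : Fin (d + 1) → ℕ) [hn : ∀ μ, NeZero (n μ)]

omit hn in
/-- Interior step `+e_μ`: `dblBox s + e_μ = dblBox (s + e_μ)`. [folklore] -/
theorem dblBox_add_unitVec {s : KingBox n} {μ : Fin (d + 1)} (h : (s μ).val + 1 < n μ) :
    dblBox n s + unitVec (dblPer n) μ = dblBox n (boxSucc n s μ h) := by
  funext ν
  by_cases hν : ν = μ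
  · subst hν; simp [dblBox, boxSucc, unitVec]
  · simp [dblBox, boxSucc, unitVec, hν]

omit hn in
/-- Interior step `−e_μ`: `dblBox s − e_μ = dblBox (s − e_μ)`. [folklore] -/
theorem dblBox_sub_unitVec {s : KingBox n} {μ : Fin (d + 1)} (h : 0 < (s μ).val) :
    dblBox n s - unitVec (dblPer n) μ = dblBox n (boxPred n s μ h) := by
  funext ν
  by_cases hν : ν = μ
  · subst hν
    simp only [dblBox, boxPred, unitVec, Pi.sub_apply, Pi.single_eq_same, Function.update_self]
    rw [sub_eq_iff_eq_add]; norm_cast; congr 1; omega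
  · simp [dblBox, boxPred, unitVec, hν]

omit hn in
/-- ★ At the FAR face the outside neighbour is the mirror image of the site itself: `σ_μ(dblBox s + e_μ) = dblBox s` when `s_μ = n_μ − 1`. [cite: King1986, §4 p.670] -/
theorem torRefl_dblBox_add_unitVec {s : KingBox n} {μ : Fin (d + 1)} (h : (s μ).val + 1 = n μ) :
    torRefl (dblPer n) μ (dblBox n s + unitVec (dblPer n) μ) = dblBox n s := by
  funext ν
  by_cases hν : ν = μ
  · subst hν
    rw [torRefl_apply_same]
    simp only [dblBox, unitVec, Pi.add_apply, Pi.single_eq_same]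
    have h2n : ((2 * n ν : ℕ) : ZMod (2 * n ν)) = 0 := ZMod.natCast_self _
    have hv : (((s ν).val : ℕ) : ZMod (2 * n ν)) + 1 = ((n ν : ℕ) : ZMod (2 * n ν)) := by norm_cast; rw [h]
    have h2 : (2 : ZMod (2 * n ν)) * ((n ν : ℕ) : ZMod (2 * n ν)) = 0 := by rw [← h2n]; push_cast; ring
    linear_combination -h2 - 2 * hv
  · rw [torRefl_apply_ne _ hν]
    simp [dblBox, unitVec, hν]

omit hn in
/-- ★ At the NEAR face: `σ_μ(dblBox s − e_μ) = dblBox s` when `s_μ = 0`. [cite: King1986, §4 p.670] -/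
theorem torRefl_dblBox_sub_unitVec {s : KingBox n} {μ : Fin (d + 1)} (h : (s μ).val = 0) :
    torRefl (dblPer n) μ (dblBox n s - unitVec (dblPer n) μ) = dblBox n s := by
  funext ν
  by_cases hν : ν = μ
  · subst hν
    rw [torRefl_apply_same]
    simp [dblBox, unitVec, h]
  · rw [torRefl_apply_ne _ hν]
    simp [dblBox, unitVec, hν]

/-- ★★ **THE REFLECTION PRINCIPLE (all `d+1` directions).**  If `F` on the doubled torus is even under every block-face reflection `σ_μ`, then
`((c(−Δ)+m²)F)(dblBox s) = ((c(−Δ_free)+m²)(F∘dblBox))(s)`: at a face of the box the torus stencil reaches the mirror image of the site itself, so the bond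
difference across the face vanishes — exactly the free boundary condition. [cite: King1986, (4.4) p.670, §4 p.670] -/
theorem lapF_mulVec_even_dblBox (c m2 : ℝ) (F : Tor (dblPer n) → ℝ) (hF : ∀ (κ : Fin (d + 1)) (z : Tor (dblPer n)), F (torRefl (dblPer n) κ z) = F z)
    (s : KingBox n) : (lapF (dblPer n) c m2 *ᵥ F) (dblBox n s) = (boxOp n c m2 *ᵥ (fun s' => F (dblBox n s'))) s := by
  rw [lapF_mulVec_apply, boxOp_mulVec_apply]
  have hplus : ∀ μ : Fin (d + 1), F (dblBox n s + unitVec (dblPer n) μ)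
      = (if h : (s μ).val + 1 < n μ then F (dblBox n (boxSucc n s μ h)) else F (dblBox n s)) := by
    intro μ
    by_cases h : (s μ).val + 1 < n μ
    · rw [dif_pos h, dblBox_add_unitVec n h]
    · rw [dif_neg h, ← hF μ (dblBox n s + unitVec (dblPer n) μ), torRefl_dblBox_add_unitVec n (by have := (s μ).isLt; omega)]
  have hminus : ∀ μ : Fin (d + 1), F (dblBox n s - unitVec (dblPer n) μ)
      = (if h : 0 < (s μ).val then F (dblBox n (boxPred n s μ h)) else F (dblBox n s)) := by
    intro μ
    by_cases h : 0 < (s μ).val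
    · rw [dif_pos h, dblBox_sub_unitVec n h]
    · rw [dif_neg h, ← hF μ (dblBox n s - unitVec (dblPer n) μ), torRefl_dblBox_sub_unitVec n (by omega)]
  simp_rw [hplus, hminus]
  have hterm : ∀ μ : Fin (d + 1),
      ((if h : (s μ).val + 1 < n μ then F (dblBox n (boxSucc n s μ h)) else F (dblBox n s))
        + (if h : 0 < (s μ).val then F (dblBox n (boxPred n s μ h)) else F (dblBox n s)))
      = 2 * F (dblBox n s) - ((if h : (s μ).val + 1 < n μ then F (dblBox n s) - F (dblBox n (boxSucc n s μ h)) else 0)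
          + (if h : 0 < (s μ).val then F (dblBox n s) - F (dblBox n (boxPred n s μ h)) else 0)) := by
    intro μ
    by_cases h1 : (s μ).val + 1 < n μ <;> by_cases h2 : 0 < (s μ).val <;>
      simp only [h1, h2, dif_pos, dif_neg, not_false_eq_true] <;> ring
  simp_rw [hterm]
  rw [Finset.sum_sub_distrib, Finset.sum_const, Finset.card_univ, Fintype.card_fin]
  simp only [nsmul_eq_mul]
  push_cast
  ring

end Reflection

/-! ## §4 The image-sum kernel and the evenness of its columns -/

section ImageKernel

variable (n : Fin (d + 1) → ℕ) [hn : ∀ μ, NeZero (n μ)]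

/-- THE BOX GREEN's FUNCTION BY IMAGES: `G^{Ω}(s,t) = Σ_{S ⊆ {0,…,d}} B⁻¹_{T(2n)}(dblBox s, σ_S(dblBox t))` — King's torus covariance of the DOUBLED torus summed
over the `2^{d+1}` reflected images of `t`. [cite: King1986, §4 p.670 («multiple reflection representations»)] -/
def kingBoxGreen (c m2 : ℝ) (s t : KingBox n) : ℝ :=
  ∑ S : Finset (Fin (d + 1)), (lapF (dblPer n) c m2)⁻¹ (dblBox n s) (torReflS (dblPer n) S (dblBox n t))

/-- The image-sum column `w ↦ Σ_S B⁻¹(w, σ_S z)` is EVEN under every `σ_κ` (reindex `S ↦ S △ {κ}` and use `B⁻¹(σw, σz) = B⁻¹(w, z)`). [cite: King1986, §4 p.670] -/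
theorem imageColumn_even (c m2 : ℝ) (z : Tor (dblPer n)) (κ : Fin (d + 1)) (w : Tor (dblPer n)) :
    ∑ S : Finset (Fin (d + 1)), (lapF (dblPer n) c m2)⁻¹ (torRefl (dblPer n) κ w) (torReflS (dblPer n) S z)
      = ∑ S : Finset (Fin (d + 1)), (lapF (dblPer n) c m2)⁻¹ w (torReflS (dblPer n) S z) := by
  have h : ∀ S : Finset (Fin (d + 1)), (lapF (dblPer n) c m2)⁻¹ (torRefl (dblPer n) κ w) (torReflS (dblPer n) S z)
      = (lapF (dblPer n) c m2)⁻¹ w (torReflS (dblPer n) (S ∆ {κ}) z) := by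
    intro S
    rw [torReflS_eq_torRefl_symmDiff (dblPer n) κ S z, lapF_inv_torRefl]
  simp_rw [h]
  exact Equiv.sum_comp (Function.Involutive.toPerm (fun S : Finset (Fin (d + 1)) => S ∆ {κ})
    (fun S => symmDiff_symmDiff_cancel_right _ S)) (fun S => (lapF (dblPer n) c m2)⁻¹ w (torReflS (dblPer n) S z))

end ImageKernel

end Summit.QuantumFields.YangMills.BalabanUVNodes.N15KingModelRung.TorusSpectral
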